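import Summits.BirchSwinnertonDyer.Rank1Residual.X5.TwoAdicTargetsB
import Summits.BirchSwinnertonDyer.Rank1Residual.X5.TwoAdicTargetsCalib
import Literature.NumberTheory.EllipticCurves.PAdicLFunctionNonsplitMultiplicativeExistenceProofs
import HarnessLib

/-!
# O1 (X5 at `p = 2`, non-CM): CALIBRATION of the non-split-multiplicative `2`-adic target, rank `0`

HONEST FRAMING (cell `b2b-bsdres`, run/shared/lean/b2b/bsd-rank1-residual/, verbatim in every
file): the goal of the cell is to DELETE the COMBINATION-SHAPED residual classes of the
Birch–Swinnerton-Dyer formula for ALL analytic-rank `≤ 1` elliptic curves over `ℚ` — "full BSD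
formula for every rank `≤ 1` curve in class `C`" assembled STRICTLY from published theorems — so
that the rank-`≤ 1` remainder becomes exactly the CONSTRUCTION-SHAPED classes, which are TYPED
(missing-input `Prop`s), NOT attempted. This is not "finishing BSD". Research routes; no claim
beyond stated classes; census output = EVIDENCE, never a Literature fact; nothing here is booked;
no mark of RESIDUAL-MAP §I moves.

Typer file 7 of the O1 class-closure folder (seat cc-typer-4); companion of
`X5/TwoAdicTargetsCalib.lean` for the sub-cell O1-nm (non-split multiplicative reduction at `2`,
1 273 residue classes). An E3 COMPARISON statement, PROVED: in analytic rank `0` the E1 target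
`O1.TwoAdicBSDNonsplitMult W D` (Mazur–Tate–Teitelbaum's BSD(`2`) at `2 ‖ N`, `a₂ = -1`, over the
multiplicative `2`-adic `L`-function `IsNonsplitMultPAdicLFunctionOf f 2 L`) is EQUIVALENT to the
classical formula `#Ш = #Ш_an` (given `Ш` finite), for every height datum `D`: the constant term is
`L(0) = 2·[0]⁺_f` (`IsNonsplitMultPAdicLFunctionOf.constantCoeff_eq`, no exceptional zero), the
multiplier on the right is the same `2` (`twoAdicBSDNonsplitMult_multiplier`), `Reg₂(D) = 1`
(`padicRegulator_eq_one_of_mordellWeilRank_eq_zero`) and `#Ш_an = ϖ·[0]⁺_f·#tors²/∏c`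
(`shaAn_eq_of_rankZero`). Such an `L` exists at every prime
(`exists_isMultPAdicLFunctionOf_neg_one_of_nonsplit`, MTT §I.10). Disegni, Kyoto J. Math. 60 (2020)
§3.2.1: in rank `0` the `p`-adic formula with `#Ш_an` "is trivial unless the reduction is split
multiplicative". Consequence for the census: on the `r = 0` rows of O1-nm the `2`-adic check X8 is
CALIBRATION. Nothing here is a Literature fact; nothing is booked.

References: [MazurTateTeitelbaum1986Invent] §I.10, §I.14 (14.3), §II.10; [GreenbergLNM1716] §4
(PDF p. 113); [Disegni2020] §3.2.1.
-/

noncomputable section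

open scoped Classical MatrixGroups ModularForm

open CongruenceSubgroup WeierstrassCurve Literature.NumberTheory.EllipticCurves
  Literature.NumberTheory.EllipticCurves.ModularForms Literature.NumberTheory.EllipticCurves.Rank1Residual
  Literature.NumberTheory.EllipticCurves.Rank1Residual.Typed

set_option autoImplicit false

namespace Summit.BirchSwinnertonDyer.Rank1Residual.X5.O1

variable (W : WeierstrassCurve ℚ) [W.IsElliptic] [W.IsGloballyMinimal]

omit [W.IsGloballyMinimal] in
/-- `[0]⁺_f ≠ 0 ⟺ L(E,1) ≠ 0` for the newform `f` of `E` (`L(E,1) = [0]⁺_f·Ω⁺_f`, `Ω⁺_f > 0`).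
[cite: MazurTateTeitelbaum1986Invent, §I.8 (8.6)] -/
theorem ratPlusSymbol_zero_ne_zero_iff {N : ℕ} [NeZero N] {f : CuspForm (Gamma0 N) 2}
    (hf : IsNewformOf W f) : ratPlusSymbol f 0 ≠ 0 ↔ W.entireLFunction 1 ≠ 0 := by
  have hpos : 0 < plusPeriod f := IsNewform0.plusPeriod_pos_holds hf.1 hf.coeffField_eq_bot
  rw [hf.entireLFunction_one_eq]
  constructor
  · intro h hL
    have h1 : ((ratPlusSymbol f 0 : ℚ) : ℝ) * plusPeriod f = 0 := by exact_mod_cast hL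
    rcases mul_eq_zero.mp h1 with h2 | h2
    · exact h (by exact_mod_cast h2)
    · exact hpos.ne' h2
  · intro h h0
    apply h
    rw [h0]
    simp

omit [W.IsGloballyMinimal] in
/-- **Clause (i) at a non-split `2` in rank `0`**: for `L` with `IsNonsplitMultPAdicLFunctionOf f 2 L`,
`ord_{T=0} L = 0 ⟺ r_an = 0` (`L(0) = 2·[0]⁺_f`, no exceptional zero).
[cite: MazurTateTeitelbaum1986Invent, §I.14 (14.3)] -/
theorem order_eq_zero_iff_analyticRank_eq_zero_of_nonsplit {N : ℕ} [NeZero N]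
    {f : CuspForm (Gamma0 N) 2} (hf : IsNewformOf W f) {L : PowerSeries ℚ_[2]}
    (hL : IsNonsplitMultPAdicLFunctionOf f 2 L) : L.order = 0 ↔ W.analyticRank = 0 := by
  haveI : Fact (Nat.Prime 2) := ⟨Nat.prime_two⟩
  rw [W.analyticRank_eq_zero_iff_holds hf.hasEntireLFunction, ← ratPlusSymbol_zero_ne_zero_iff W hf]
  have h0 : ((0 : ℕ) : ℕ∞) = 0 := Nat.cast_zero
  rw [← h0, PowerSeries.order_eq_nat, PowerSeries.coeff_zero_eq_constantCoeff, hL.constantCoeff_eq]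
  simp only [Nat.not_lt_zero, IsEmpty.forall_iff, implies_true, and_true]
  constructor
  · intro h h0'
    exact h (by rw [h0']; simp)
  · intro h h2
    exact h (by exact_mod_cast (mul_eq_zero.mp h2).resolve_left two_ne_zero)

omit [W.IsGloballyMinimal] in
/-- **Clause (ii) at a non-split `2` in rank `0`** is the rational identity
`ϖ·[0]⁺_f·#tors² = #Ш·∏c` (multiplier `2` on both sides, `Reg₂(D) = 1`).
[cite: MazurTateTeitelbaum1986Invent, §II.10] [cite: GreenbergLNM1716, §4 (PDF p. 113)] -/
theorem twoAdicLeadingTermNonsplit_iff_of_rankZero (hr : W.mordellWeilRank = 0) {N : ℕ} [NeZero N]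
    {f : CuspForm (Gamma0 N) 2} {L : PowerSeries ℚ_[2]} (hL : IsNonsplitMultPAdicLFunctionOf f 2 L)
    (D : PAdicHeightData W 2) (ϖ : ℚ) :
    ((ϖ : ℚ_[2]) * PowerSeries.coeff W.mordellWeilRank L *
          padicLog 2 (cyclotomicGenerator 2) ^ W.mordellWeilRank * (W.torsionOrder : ℚ_[2]) ^ 2 =
        (1 - (-1 : ℚ_[2])⁻¹) * (W.shaOrder * padicRegulator D * W.tamagawaProduct)) ↔
      ϖ * ratPlusSymbol f 0 * (W.torsionOrder : ℚ) ^ 2 = W.shaOrder * W.tamagawaProduct := by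
  haveI : Fact (Nat.Prime 2) := ⟨Nat.prime_two⟩
  rw [hr, pow_zero, mul_one, PowerSeries.coeff_zero_eq_constantCoeff, hL.constantCoeff_eq,
    padicRegulator_eq_one_of_mordellWeilRank_eq_zero W 2 hr D, mul_one, twoAdicBSDNonsplitMult_multiplier]
  constructor
  · intro h
    have h' : (2 : ℚ_[2]) * ((ϖ : ℚ_[2]) * (ratPlusSymbol f 0 : ℚ_[2]) * (W.torsionOrder : ℚ_[2]) ^ 2) =
        2 * ((W.shaOrder : ℚ_[2]) * (W.tamagawaProduct : ℚ_[2])) := by rw [← h]; ring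
    have h'' := mul_left_cancel₀ (two_ne_zero : (2 : ℚ_[2]) ≠ 0) h'
    exact_mod_cast h''
  · intro h
    have h' : (ϖ : ℚ_[2]) * (ratPlusSymbol f 0 : ℚ_[2]) * (W.torsionOrder : ℚ_[2]) ^ 2 =
        (W.shaOrder : ℚ_[2]) * (W.tamagawaProduct : ℚ_[2]) := by exact_mod_cast h
    linear_combination (2 : ℚ_[2]) * h'

/-- **`TwoAdicBSDNonsplitMult ⟹ #Ш = #Ш_an` in rank `0`** (non-split multiplicative `2`,
`rank_ℤ E(ℚ) = 0 = r_an`, newform `f` with period ratio `ϖ`; the `2`-adic `L`-function at the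
non-split prime EXISTS, `exists_isMultPAdicLFunctionOf_neg_one_of_nonsplit`).
[cite: MazurTateTeitelbaum1986Invent, §II.10] -/
theorem shaAn_eq_shaOrder_of_twoAdicBSDNonsplitMult_of_rankZero (hmult : Mult W 2)
    (hns : ¬ W.HasSplitMultiplicativeReductionAtPrime 2) (hr : W.mordellWeilRank = 0)
    (han : W.analyticRank = 0) {N : ℕ} [NeZero N] {f : CuspForm (Gamma0 N) 2}
    (hf : IsNewformOf W f) (ϖ : ℚ) (hϖ : (ϖ : ℝ) * W.realPeriodRat = plusPeriod f)
    {D : PAdicHeightData W 2} (h : TwoAdicBSDNonsplitMult W D) (hfin : Finite W.sha) :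
    shaAn W = W.shaOrder := by
  haveI : Fact (Nat.Prime 2) := ⟨Nat.prime_two⟩
  obtain ⟨L, hL⟩ := exists_isMultPAdicLFunctionOf_neg_one_of_nonsplit (p := 2) hf hmult hns
  have h2 := (h hmult hns f hf L hL).2 hfin ϖ hϖ
  exact (shaAn_eq_shaOrder_iff_of_rankZero W hr han hf ϖ hϖ).mpr
    ((twoAdicLeadingTermNonsplit_iff_of_rankZero W hr hL D ϖ).mp h2)

omit [W.IsElliptic] [W.IsGloballyMinimal] in
/-- **`#Ш = #Ш_an ⟹ TwoAdicBSDNonsplitMult` in rank `0`, for EVERY height datum and every `L`.**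
[cite: MazurTateTeitelbaum1986Invent, §II.10] -/
theorem twoAdicBSDNonsplitMult_of_rankZero_of_shaAn_eq (hr : W.mordellWeilRank = 0)
    (han : W.analyticRank = 0) (hBSD : Finite W.sha → shaAn W = W.shaOrder)
    (D : PAdicHeightData W 2) : TwoAdicBSDNonsplitMult W D := by
  haveI : Fact (Nat.Prime 2) := ⟨Nat.prime_two⟩
  intro _ _ _ _ N _ f hf L hL
  refine ⟨?_, fun hfin ϖ hϖ => ?_⟩
  · rw [hr, Nat.cast_zero]
    exact (order_eq_zero_iff_analyticRank_eq_zero_of_nonsplit W hf hL).mpr han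
  · exact (twoAdicLeadingTermNonsplit_iff_of_rankZero W hr hL D ϖ).mpr
      ((shaAn_eq_shaOrder_iff_of_rankZero W hr han hf ϖ hϖ).mp (hBSD hfin))

/-- **CALIBRATION (rank `0`, non-split multiplicative `2`):
`TwoAdicBSDNonsplitMult W D ⟺ (Ш finite ⇒ #Ш_an = #Ш)`**, for every height datum `D`.
[cite: MazurTateTeitelbaum1986Invent, §II.10] [cite: Disegni2020, §3.2.1] -/
theorem twoAdicBSDNonsplitMult_iff_of_rankZero (hmult : Mult W 2)
    (hns : ¬ W.HasSplitMultiplicativeReductionAtPrime 2) (hr : W.mordellWeilRank = 0)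
    (han : W.analyticRank = 0) {N : ℕ} [NeZero N] {f : CuspForm (Gamma0 N) 2}
    (hf : IsNewformOf W f) (ϖ : ℚ) (hϖ : (ϖ : ℝ) * W.realPeriodRat = plusPeriod f)
    (D : PAdicHeightData W 2) :
    TwoAdicBSDNonsplitMult W D ↔ (Finite W.sha → shaAn W = W.shaOrder) :=
  ⟨fun h hfin =>
      shaAn_eq_shaOrder_of_twoAdicBSDNonsplitMult_of_rankZero W hmult hns hr han hf ϖ hϖ h hfin,
    fun h => twoAdicBSDNonsplitMult_of_rankZero_of_shaAn_eq W hr han h D⟩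

/-- With Gross–Zagier–Kolyvagin (`hGZK`): on an `r_an = 0` row with non-split multiplicative `2`,
`TwoAdicBSDNonsplitMult W D ⟺ #Ш_an = #Ш`. [folklore] -/
theorem twoAdicBSDNonsplitMult_iff_shaAn_eq_of_analyticRank_eq_zero
    (hGZK : rank_eq_analyticRank_of_analyticRank_le_one) (hmult : Mult W 2)
    (hns : ¬ W.HasSplitMultiplicativeReductionAtPrime 2) (han : W.analyticRank = 0) {N : ℕ}
    [NeZero N] {f : CuspForm (Gamma0 N) 2} (hf : IsNewformOf W f) (ϖ : ℚ)
    (hϖ : (ϖ : ℝ) * W.realPeriodRat = plusPeriod f) (D : PAdicHeightData W 2) :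
    TwoAdicBSDNonsplitMult W D ↔ shaAn W = W.shaOrder := by
  have hle : W.analyticRank ≤ 1 := by rw [han]; exact zero_le_one
  have hr : W.mordellWeilRank = 0 := by rw [(hGZK W hle).1, han]
  have hfin : Finite W.sha := (hGZK W hle).2
  rw [twoAdicBSDNonsplitMult_iff_of_rankZero W hmult hns hr han hf ϖ hϖ D]
  exact ⟨fun h => h hfin, fun h _ => h⟩

end Summit.BirchSwinnertonDyer.Rank1Residual.X5.O1

end
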